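import Summits.AnomalousDissipation.AnomalousDissipation.Theorems.SolenoidalFractalHomogenisationLagrangianCarrierConstructionRegularLUnique
import HarnessLib

/-!
# K3L `LagrangianCarrierConstruction` (stmt-AnomalousDissipation-24913), line `birth`, stub `stub_regularL`: the FIRST RUNG of the distortion
# bootstrap — a sup bound of every level field by the Lipschitz constant of the coarse field over one refresh window
# (helper; `--supports stmt-AnomalousDissipation-24913`)

Summits-side helper file (everything proved; no definitions, no named facts). For the abstract Lagrangian lattice carrier of `stub_regularL`
(`IsLagrangian` + (L1), (L3a), (L3b), (F1a)): if the lifted coarse field `B_m(t, ·) = (b 1 + ⋯ + b m)(t, proj ·)` is `K`-Lipschitz at every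
time, then `‖b (m+1) t x‖ ≤ exp(K · refresh (m+1)) · k a_{m+1} / (2π N_{m+1})` for all `t, x` (`norm_b_le_exp_mul`): by `IsInserted` the level is
the Eulerian level (sup `≤ k a_{m+1}/(2π N_{m+1})`) pushed forward by the flow derivative `flowDeriv m t w`, which — the displacements being
the evolution maps of `B_m` (`…RegularLFlow`), restarted at the window's left end `w`, `t − w ≤ refresh (m+1)` — has operator norm at most the
Lipschitz constant `exp(K (t − w))` of the evolution map (Grönwall, `IsUniformlyLipschitzOn.dist_evolutionMap_le`). With `K ≲ a 1 + ⋯ + a m` this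
is `exp(C · strain m) ≤ exp(C θ_{m+1})` — the shape in which the strain clause (S) enters LEVEL-BOUNDS; bounding `K` that way is the
higher-order part of the bootstrap (Armstrong–Vicol §5.1), not done here. Infrastructure for route-1's rung leaf F-D1.A0 (a frontier FORMAL
rung); NOT a proof of anomalous dissipation.
-/

set_option linter.dupNamespace false

noncomputable section

namespace Summit.AnomalousDissipation.AnomalousDissipation.Theorems.SolenoidalFractalHomogenisation.LagrangianCarrierConstruction

open Set Function Filter Topology MeasureTheory
open scoped NNReal ContDiff
open Literature.Analysis Literature.Analysis.ODE Literature.Analysis.FunctionSpaces Literature.Analysis.FunctionSpaces.Torus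
open Literature.Analysis.FluidPDE Literature.Analysis.FluidPDE.LatticeShear
open Summit.AnomalousDissipation.AnomalousDissipation.Theorems.SolenoidalFractalHomogenisation.PermissibleCarrier (norm_level_le)

variable {k : ℕ}

/-- Under the identification of the displacements with evolution maps, the lifted displacement is `φ(s → t) − id`. [folklore] -/
theorem lift_disp_eq_evolutionMap_sub (E : LagrangianLatticeCarrier k) (m : ℕ) (hflow : E.IsFlow m)
    (h1 : ∀ m, Continuous (uncurry (E.b (m + 1)))) (h3a : ∀ m t, IsSmooth (E.b (m + 1) t))
    (h3b : ∀ m (n : ℕ), ∃ C : ℝ, ∀ t y, ‖iteratedFDeriv ℝ n (Torus.lift (E.b (m + 1) t)) y‖ ≤ C)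
    (hF1a : ∀ m s, Continuous fun p : ℝ × UnitAddTorus (Fin 3) => E.disp m p.1 s p.2) (t s : ℝ) :
    Torus.lift (E.disp m t s) = fun z => evolutionMap (fun t (z : EuclideanSpace ℝ (Fin 3)) => E.partialSum m t (proj z)) s t z - z := by
  funext z
  rw [Torus.lift_apply]
  have h := repr_add_disp_eq_evolutionMap E m hflow h1 h3a h3b hF1a t s (proj z)
  obtain ⟨n, hn⟩ := exists_repr_proj_eq_add_latticeVec_holds z
  rw [hn, evolutionMap_add_latticeVec (isUniformlyLipschitzOn_partialSum_proj E h1 h3a h3b m)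
    (partialSum_proj_add_latticeVec E m) s t] at h
  -- `h : z + n + disp = φ z + n`
  have e : E.disp m t s (proj z) = (z + latticeVec n + E.disp m t s (proj z)) - (z + latticeVec n) := by abel
  rw [e, h]
  abel

/-- The flow derivative has operator norm at most the Lipschitz constant of the evolution map. [folklore] -/
theorem norm_flowDeriv_le (E : LagrangianLatticeCarrier k) (m : ℕ) (hflow : E.IsFlow m)
    (h1 : ∀ m, Continuous (uncurry (E.b (m + 1)))) (h3a : ∀ m t, IsSmooth (E.b (m + 1) t))
    (h3b : ∀ m (n : ℕ), ∃ C : ℝ, ∀ t y, ‖iteratedFDeriv ℝ n (Torus.lift (E.b (m + 1) t)) y‖ ≤ C)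
    (hF1a : ∀ m s, Continuous fun p : ℝ × UnitAddTorus (Fin 3) => E.disp m p.1 s p.2)
    {K : ℝ≥0} (hK : ∀ t, LipschitzWith K fun z : EuclideanSpace ℝ (Fin 3) => E.partialSum m t (proj z)) (t s : ℝ)
    (y : UnitAddTorus (Fin 3)) : ‖E.flowDeriv m t s y‖ ≤ Real.exp (K * |t - s|) := by
  have hB := isUniformlyLipschitzOn_partialSum_proj E h1 h3a h3b m
  set Φ : EuclideanSpace ℝ (Fin 3) → EuclideanSpace ℝ (Fin 3) :=
    evolutionMap (fun t (z : EuclideanSpace ℝ (Fin 3)) => E.partialSum m t (proj z)) s t with hΦ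
  have hΦL : LipschitzWith (Real.exp (K * |t - s|)).toNNReal Φ := by
    refine LipschitzWith.of_dist_le_mul fun x' y' => ?_
    have h := hB.dist_evolutionMap_le convex_univ (mem_univ s) (mem_univ t) (fun r _ => hK r) x' y'
    rw [Real.coe_toNNReal _ (Real.exp_pos _).le, mul_comm]
    exact h
  have hl := lift_disp_eq_evolutionMap_sub E m hflow h1 h3a h3b hF1a t s
  unfold LagrangianLatticeCarrier.flowDeriv
  rw [hl]
  have h1e : (1 : ℝ) ≤ Real.exp (K * |t - s|) := Real.one_le_exp (mul_nonneg K.2 (abs_nonneg _))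
  by_cases hd : DifferentiableAt ℝ (fun z => Φ z - z) (repr y)
  · have hfun : Φ = fun z => (Φ z - z) + z := by funext z; simp
    have e : ContinuousLinearMap.id ℝ (EuclideanSpace ℝ (Fin 3)) + fderiv ℝ (fun z => Φ z - z) (repr y) = fderiv ℝ Φ (repr y) := by
      conv_rhs => rw [hfun]
      rw [fderiv_fun_add hd differentiableAt_fun_id, fderiv_fun_id]
      abel
    rw [e]
    exact (norm_fderiv_le_of_lipschitzWith hΦL (repr y)).trans (by rw [Real.coe_toNNReal _ (Real.exp_pos _).le])
  · rw [fderiv_zero_of_not_differentiableAt hd, add_zero]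
    exact ContinuousLinearMap.norm_id_le.trans h1e

/-- **First rung of the distortion bootstrap: sup bound of a level by the coarse Lipschitz constant over one window.**
`‖b (m+1) t x‖ ≤ exp(K · refresh (m+1)) · k a_{m+1} / (2π N_{m+1})`. [cite: ArmstrongVicol2025, §5.1 (flow estimates over one renewal window) and
§2.2 (PDF p. 18: |b_m − b_{m−1}| ≲ a_m ε_m through ∇X_{m−1})] -/
theorem norm_b_le_exp_mul (E : LagrangianLatticeCarrier k) (m : ℕ) (hL : E.IsLagrangian)
    (h1 : ∀ m, Continuous (uncurry (E.b (m + 1)))) (h3a : ∀ m t, IsSmooth (E.b (m + 1) t))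
    (h3b : ∀ m (n : ℕ), ∃ C : ℝ, ∀ t y, ‖iteratedFDeriv ℝ n (Torus.lift (E.b (m + 1) t)) y‖ ≤ C)
    (hF1a : ∀ m s, Continuous fun p : ℝ × UnitAddTorus (Fin 3) => E.disp m p.1 s p.2)
    {K : ℝ≥0} (hK : ∀ t, LipschitzWith K fun z : EuclideanSpace ℝ (Fin 3) => E.partialSum m t (proj z)) (t : ℝ)
    (x : UnitAddTorus (Fin 3)) :
    ‖E.b (m + 1) t x‖ ≤ Real.exp (K * E.refresh (m + 1)) * (k * E.a (m + 1) / (2 * Real.pi * E.N (m + 1))) := by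
  set j : ℤ := ⌊t / E.refresh (m + 1)⌋ with hj
  have ht : t ∈ E.window (m + 1) j := mem_window_floor E (m + 1) t
  obtain ⟨y, hy⟩ := surjective_X_of_regular E m (hL m).1 h1 h3a h3b hF1a t ((j : ℝ) * E.refresh (m + 1)) x
  have hins := (hL m).2 j t ht y
  rw [hy] at hins
  rw [hins]
  have hts : |t - (j : ℝ) * E.refresh (m + 1)| ≤ E.refresh (m + 1) := by
    rw [abs_of_nonneg (by linarith [ht.1])]
    linarith [ht.2]
  calc ‖E.flowDeriv m t ((j : ℝ) * E.refresh (m + 1)) y (E.toFractalCarrierData.level (m + 1) t y)‖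
      ≤ ‖E.flowDeriv m t ((j : ℝ) * E.refresh (m + 1)) y‖ * ‖E.toFractalCarrierData.level (m + 1) t y‖ :=
        ContinuousLinearMap.le_opNorm _ _
    _ ≤ Real.exp (K * |t - (j : ℝ) * E.refresh (m + 1)|) * (k * E.a (m + 1) / (2 * Real.pi * E.N (m + 1))) :=
        mul_le_mul (norm_flowDeriv_le E m (hL m).1 h1 h3a h3b hF1a hK t _ y) (norm_level_le _ _ t y) (norm_nonneg _)
          (Real.exp_pos _).le
    _ ≤ Real.exp (K * E.refresh (m + 1)) * (k * E.a (m + 1) / (2 * Real.pi * E.N (m + 1))) := by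
        have hpos : 0 ≤ (k : ℝ) * E.a (m + 1) / (2 * Real.pi * E.N (m + 1)) := by
          have := E.toFractalCarrierData.a_pos (m + 1); have := E.toFractalCarrierData.N_pos (m + 1); positivity
        exact mul_le_mul_of_nonneg_right (Real.exp_le_exp.mpr (mul_le_mul_of_nonneg_left hts K.2)) hpos

end Summit.AnomalousDissipation.AnomalousDissipation.Theorems.SolenoidalFractalHomogenisation.LagrangianCarrierConstruction

end
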